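import Summits.QuantumFields.BalabanUV.T4Continuum.Support.NE9CurOfOneInstanceChartEnd
import Summits.QuantumFields.BalabanUV.T4Continuum.Support.NE9CurChartOneInstanceUniformBall

/-!
# NE9CurOfOneInstanceChartEndUniform — T25 READ AT THE END FACE ON ONE PAIR OF BALLS: (C′)
# `Support/NE9CurOfOneInstanceChartEnd.termSize_ne9_and_fadingMemory_compCur_of_oneInstance_smallField` (NE9 leaf-06's END-COMP
# `NE9CurveFromBackgroundMapEnd.termSize_ne9_and_fadingMemory_compCur_margProj_cpieceForm` FED by the one-instance chart of `cur U` WITH the J-term)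
# with the T-slot radii, the chart radii and the current threshold chosen BEFORE `∀ U` (this lineage's gen-68 (A″)
# `NE9CurChartOneInstanceUniformBall.cur_chart_exists_oneInstance_smallField_uniform_smallJ`); cell `pub-balaban`, T4-DAG §2 node U3 ∕ §6 NE9, route
# R2′ of `t4/ROUTES-NE9.md`; NE9 crux-team leaf lineage `b2b-balaban-t4-ne9-formalise-leaf-05`, generation 68; Summits-side NEW leaf under this seat's
# INTERFACE REQUEST NE9 of this generation (a separate file because the host (C′) (299 l.) would exceed the 400-line rule); nothing printed asserted

HONEST FRAMING (T4-DAG PAGE 1).  Rung (B)+1 of the FINITE-VOLUME T⁴ programme — NOT infinite volume, NOT a mass gap, NOT the Clay problem.  NE9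
(`T4OutputRate.NE9` ∧ `FadingMemory`) is a cell NEW ESTIMATE, NOT PRINTED in [I] = [Balaban1987RG1] (CMP **109**), [II] = [Balaban1988RG2Cluster]
(CMP **116**), and NOT PROVED here («NE9 ⇐ the named binders»; spine PROVED 0∕9).  HONEST DEPENDENCY (cell line, verbatim): continuum YM on T⁴ ⇐
BetaPertH ∧ nine spine estimates (0/9 proved); BetaPertH ⇐ (D1) ∧ (D4) ∧ CAP+tail; G-an2-4 gates asym, D1 and NE2/3/4.  The `cur U` OBJECT is ONE
item of the MODEL O-NE9-1 (species (a) data); the END's `act` ∕ `ker` halves and NEEDS-COORDINATOR #5 are untouched.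

WHAT THIS FILE PROVES (ONE theorem; 0 def, 0 sorry, axioms standard).  **`termSize_ne9_and_fadingMemory_compCur_of_oneInstance_uniform_smallJ`** —
(C′) §2 with the quantifier prefix of (A″) §3: given the fibre∕trace letters, `0 < a`, the fixed (L3) operators `ρ`, `τc`, V₀-slot letters
`C_V ≥ 0`, `R_V > 0`, current bounds `M_J > 0`, `M_Δ ≥ 0`, and END-COMP's binders NOT mentioning the curve datum VERBATIM: THERE ARE `ε₃ > 0`, T-slot
radii `a_C, ε_C > 0`, chart radii `ε₄, R_b, R′ > 0` and a current threshold `0 < j₁ ≤ M_J` — ALL BEFORE `∀ U` — such that for EVERY background `U` of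
E162's data with `‖U(b) − 1‖ ≤ ε ≤ ε₃`, `hRS`, the V₀-group's slot at `(C_V, R_V)`, ALL currents with `‖J‖₍₋₃₎ ≤ j₁`, `‖Δπ‖ ≤ M_Δ`: `hpos(U)` HOLDS and
for ALL per-domain readings `ιr X`, `πr X` with `ιr X (ball 0 (Dd.R X)) ⊆ ball 0 R_b`, `πr X (ball 0 R′) ⊆ ball 0 (R₁ X)` (inclusions against the
FIXED radii), every `Φ` agreeing with the read one-instance chart, and the six END-COMP binders mentioning `Dd.compCur Φ R₁`, the END face
`TermSize ∧ NE9 ∧ FadingMemory` holds — «⇐ the named binders», with NO positivity binder, NO `‖𝔊(U) ∘L L_J‖ < 1`, NO U-dependent radius displayed.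
MECHANISM: (A″) §3 + (C′) §1 `termSize_ne9_and_fadingMemory_compCur_of_chart` (generic Φ₀ with (Ψ1)–(Ψ3)).
DISGUISE TEST: composition by name; no inequality of the series proved; per LATTICE; NOT claimed that Bałaban's 𝐇_k ∕ U_j(□₀, exp iB) ∕ U^c_j meet
the readings' ball inclusions or END-COMP's displayed binders (O-NE9-1 ∕ O-NE9-5; #5 UNRULED); not NE9.
References (TYPES ∕ loci only): [Balaban1985Variational] (45)–(47) p. 285, Prop. 4 (97)–(98) pp. 292–293, Prop. 6 (117)–(121) p. 295, (172)–(175)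
p. 305; [Balaban1985BackgroundPropagators] Thm 3.11 p. 416, (3.126) p. 420, (3.153) p. 426; [Balaban1987RG1] (1.18) p. 256, Lemma 4 (3.53) p. 280;
[Balaban1988RG2Cluster] Lemma 1 (1.36), Lemma 2 (1.41)–(1.43), (2.15)–(2.22).
Imports (C′) `Support/NE9CurOfOneInstanceChartEnd` (gen 67) and (A″) `Support/NE9CurChartOneInstanceUniformBall` (gen 68) ONLY; modifies nothing; no
END re-wired.  Value = route R2′ bookkeeping at rung (B)+1 (T25's END-face reading on a U-INDEPENDENT pair of balls), NOT summit progress.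
-/

noncomputable section

namespace Summit.QuantumFields.BalabanUV.T4Continuum.NE9CurOfOneInstanceChartEndUniform


open scoped BigOperators InnerProductSpace
open Metric Set
open Literature.MathematicalPhysics.QuantumFieldTheory.Balaban1983to89
open Literature.MathematicalPhysics.QuantumFieldTheory.Balaban1983to89.T4OutputRate
open Literature.MathematicalPhysics.QuantumFieldTheory.Balaban1983to89.T4HistoryLipschitzRecursion
open Literature.MathematicalPhysics.QuantumFieldTheory.Balaban1983to89.T4HistoryLipschitzOuter
open Literature.MathematicalPhysics.QuantumFieldTheory.Balaban1983to89.T4HistoryLipschitzActivity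
open Literature.MathematicalPhysics.QuantumFieldTheory.Balaban1983to89.T4HistoryLipschitzActivity (ClusterGeom)
open Literature.MathematicalPhysics.QuantumFieldTheory.Balaban1983to89.T4HistoryLipschitzSegment
open Summit.QuantumFields.BalabanUV.T4Continuum.NE9Lemma1Counting
open Summit.QuantumFields.BalabanUV.T4Continuum.NE9Lemma1Gain
open Summit.QuantumFields.BalabanUV.T4Continuum.NE9Lemma1PieceClass
open Summit.QuantumFields.BalabanUV.T4Continuum.NE9Lemma1RemainderSpecies
open Summit.QuantumFields.BalabanUV.T4Continuum.NE9Lemma1CurveSpecies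
open Summit.QuantumFields.BalabanUV.T4Continuum.NE9ComplexEncoding (doubleCarriers)
open Summit.QuantumFields.BalabanUV.T4Continuum.NE9LastCouplingBridge
open Summit.QuantumFields.BalabanUV.T4Continuum.NE9BridgeSizeInduction
open Summit.QuantumFields.BalabanUV.T4Continuum.NE9MarginalProjection
open Summit.QuantumFields.BalabanUV.T4Continuum.NE9MarginalProjectionEnd
open Summit.QuantumFields.BalabanUV.T4Continuum.NE9CurveFromBackgroundMap
open Summit.QuantumFields.BalabanUV.T4Continuum.NE9CurveFromBackgroundMapEnd (termSize_ne9_and_fadingMemory_compCur_margProj_cpieceForm)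
open Summit.QuantumFields.BalabanUV.T4Continuum.NE9CurOfB11Chart (triple_read)
open B11Eq103H1Complex B11Eq115Space B11Eq174Chart
open B11Eq111FrakG (nabla115)
open B9Eq319QprimeTorus (fineP)
open B9SectCLatticeCarrier (Bond)
open B4Sect5Torus (TSite)
open B7Prop1Explicit (U1 Wcx boxVec)
open B9Eq315QTorus (perCfg cornerSite QtorusW laplaceAofBackground)
open B9Eq315QTorusOnto (QtorusW_surjective)
open B9Eq310HessianOperator (adTransportW)
open B11Eq44COperatorTorus (Cc)
open B11Eq63V0GroupCurrent (curV0)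
open B11Eq80Current (W80)
open B11Eq79LinearTerm (LJ)
open Summit.QuantumFields.BalabanUV.T4Continuum.NE9CurChartOneInstanceUniformBall (cur_chart_exists_oneInstance_smallField_uniform_smallJ)
open Summit.QuantumFields.BalabanUV.T4Continuum.NE9CurOfOneInstanceChartEnd (termSize_ne9_and_fadingMemory_compCur_of_chart)

variable {C₀ : Carriers} {E : Type} [NormedAddCommGroup E] [NormedSpace ℂ E] {ι' αι β γ δ : Type} [DecidableEq δ]

variable (G : ClusterGeom (doubleCarriers C₀)) {Pot : Type*} [NormedAddCommGroup Pot] [NormedSpace ℂ Pot]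



section UniformBall

set_option maxRecDepth 8192 in
/-- **T25 AT THE END FACE ON ONE PAIR OF BALLS FOR THE WHOLE SMALL-FIELD FAMILY AND ALL SMALL CURRENTS** — (C′) §2 with `∃ ε₃ a_C ε_C ε₄ R_b R′ j₁`
BEFORE `∀ U` (this lineage's (A″) §3) and END-COMP applied through (C′) §1: `hpos(U)` PRODUCED, the readings' inclusions against FIXED radii, the six
curve-datum binders and the 45 other END-COMP arguments VERBATIM (51 after the nine chart∕reading ones), conclusion `TermSize ∧ NE9 ∧ FadingMemory`
«⇐ the named binders». [folklore] -/
theorem termSize_ne9_and_fadingMemory_compCur_of_oneInstance_uniform_smallJ {d : ℕ} (L : ℕ) [NeZero L] (m : Fin d → ℕ)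
    [∀ i, NeZero (fineP L m i)] (hL : 1 ≤ L)
    {𝔸 : Type*} [NormedRing 𝔸] [NormedAlgebra ℂ 𝔸] [CompleteSpace 𝔸] [NormOneClass 𝔸] [StarRing 𝔸] [NormedStarGroup 𝔸] [StarModule ℂ 𝔸]
    [FiniteDimensional ℂ 𝔸]
    {W : Type*} [NormedAddCommGroup W] [InnerProductSpace ℂ W] [FiniteDimensional ℂ W] (φ : W ≃ₗ[ℂ] 𝔸) {Mφ Mφ' : ℝ} (hMφ : 0 ≤ Mφ)
    (hMφ' : 0 ≤ Mφ') (hφ : ∀ w, ‖φ w‖ ≤ Mφ * ‖w‖) (hφ' : ∀ X, ‖φ.symm X‖ ≤ Mφ' * ‖X‖)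
    (τ : 𝔸 →ₗ[ℂ] ℂ) {Cτ : ℝ} (hτ : ∀ X, ‖τ X‖ ≤ Cτ * ‖X‖) (hCτ : 0 ≤ Cτ)
    {η : ℝ} [Fact (0 < (L : ℝ))] [Fact (0 < η)] {lev₀ : Bond d (fineP L m) → ℕ} {levB : Bond d m → ℕ} (lev₁ : Bond d (fineP L m) × Fin d → ℕ)
    (hlev : ∀ b, 1 ≤ lev₀ b) {c₀ c₁ : ℝ} [Fact (0 < c₀)] [Fact (0 < c₁)] {a : ℝ} (ha : 0 < a)
    (ρ : (𝔸 →L[ℂ] ℂ) →L[ℂ] 𝔸) (τc : 𝔸 →L[ℂ] ℂ) {CV RV MJ MΔ : ℝ} (hCV : 0 ≤ CV) (hRV : 0 < RV) (hMJ : 0 < MJ) (hMΔ : 0 ≤ MΔ)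
    -- END-COMP's binders NOT mentioning the curve datum, verbatim (bound names as in the module docstring)
    {Dd : RemData C₀ E ι' αι β γ δ} {R₁ : C₀.Dom → ℝ} {ℓg : ℕ → ℕ → ℝ} {cdir d0 : ℝ}
    {Ef : Functional (doubleCarriers C₀) E} {Wd : Set (ℕ → ℝ)} {Adm S : Set (E → (doubleCarriers C₀).Dom → ℝ)}
    {r : ℕ → (E → (doubleCarriers C₀).Dom → ℝ) → ℝ} {A : E → (doubleCarriers C₀).Dom → ℝ}
    {ΨF : ℕ → ℝ → (ι' → ℝ) → E → (doubleCarriers C₀).Dom → ℝ} {act : ℕ → ℝ → E → Pot → G.P → ℂ} {𝒜 : ℕ → Set Pot}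
    {n : ℕ → ℝ → E → G.P → ℝ} {lip clip : ℕ → ℝ} {aP dP : G.P → ℝ} {δv : (doubleCarriers C₀).Dom → ℝ}
    {κw O1 cQ ω clipd Nbar B lipbar clipbar cr aA : ℝ} {p₀ N : ℕ → ℝ}
    (ρP : ℕ → (ι' → ℝ) → Pot) (U₀ : E) (explZ : ℕ → E → (doubleCarriers C₀).Dom → ℝ) (h0 : ScaleZeroFree Ef Wd)
    (hAdm : AdmissibleTerms Ef Wd Adm) (hres : AdmRestrict Adm)
    (hDd : Dd.Admissible ℓg cdir d0) (hdirB0 : ∀ k s y a' b x, 0 < Dd.dirB k s y a' b x)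
    (hdirC : ∀ k s y a' b x, Continuous fun p : ℂ × (δ → ℝ) × (δ → ℂ) => Dd.dir k s y a' b x p.1 p.2.1 p.2.2)
    (hdirB : ∀ k s y a' b x t s' σ', ‖Dd.dir k s y a' b x t s' σ'‖ ≤ Dd.dirB k s y a' b x)
    (hrA : ReadAdditive Adm r) (hr0 : ReadZero r) (hrs : ReadSize Adm r κw cr) (hA : DirSize A κw aA) (hcr : 0 ≤ cr)
    (haA : 0 ≤ aA)
    (hAmul : ∀ c : ℕ → ℝ, (fun U X' => c ((doubleCarriers C₀).scale X') * A U X') ∈ Adm)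
    (hcoef : ∀ (j : ℕ) (c : ℝ), r j (restrictScale j (c • A)) = c * r j (restrictScale j A))
    (hnorm : ∀ j : ℕ, r j (restrictScale j A) = 1 ∨ ∀ H ∈ Adm, r j (restrictScale j H) = 0)
    (hS : ∀ H ∈ Adm, margProj r A H ∈ S)
    (hclipd : 0 ≤ clipd) (hcdir : 0 < cdir) (hℓpos : ∀ k j, 0 < ℓg k j) (hhalf : ∀ k j, cdir * ℓg k j < 1 / 2)
    (hcont : ∀ (k : ℕ) (s : ℕ → ℝ) (y : ι') (a' : αι) (b : β) (x : (doubleCarriers C₀).Dom),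
      ContinuousOn (fun p : ℂ × ((δ → ℝ) × (δ → ℂ)) => Dd.dir k s y a' b x p.1 p.2.1 p.2.2)
        (sphere (0:ℂ) (Dd.r k) ×ˢ {q | OnContour Dd.κ₁ (Dd.cubes k y a' b) q.1 q.2}))
    (hlip : ∀ g ∈ Wd, ∀ g' ∈ Wd, ∀ (k : ℕ) (y : ι'), ∀ a' ∈ Dd.S0 k y, ∀ b ∈ Dd.SY k y a', ∀ (j : ℕ), ∀ x ∈ Dd.src k y a' j,
      ∀ t ∈ sphere (0:ℂ) (Dd.r k), ∀ (s' : δ → ℝ) (σ' : δ → ℂ), OnContour Dd.κ₁ (Dd.cubes k y a' b) s' σ' →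
        ‖Dd.dir k g y a' b x t s' σ' - Dd.dir k g' y a' b x t s' σ'‖ ≤ clipd * (cdir * ℓg k j * Dd.R x.1) * |g k - g' k|)
    (hO1 : 0 ≤ O1) (hcQ : 0 ≤ cQ) (hω0 : 0 ≤ ω) (hω1 : ω < 1) (hNb : ∀ j, N j ≤ Nbar) (hclip0 : ∀ k, 0 ≤ clip k)
    (hCup : ∀ g ∈ Wd, ∀ g' ∈ Wd, ∀ (k : ℕ) (Ue : E) (X : (doubleCarriers C₀).Dom), (doubleCarriers C₀).scale X = k + 1 →
      ∀ Q ∈ 𝒜 k, ∀ γ' ∈ G.vol X,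
      ‖act k (g k) Ue Q γ'‖ ≤ n k (g' k) Ue γ' ∧
        ‖act k (g k) Ue Q γ' - act k (g' k) Ue Q γ'‖ ≤ clip k * |g k - g' k| * n k (g' k) Ue γ')
    (hreprV : ∀ (k : ℕ) (s : ℝ) (Q : ι' → ℝ) (Ue : E) (X : (doubleCarriers C₀).Dom),
      ΨF k s Q Ue X = (G.newTerm act k s Ue X (ρP k Q)).re - (G.newTerm act k s U₀ X (ρP k Q)).re + explZ k Ue X)
    (hclipb : ∀ k, clip k ≤ clipbar)
    (hK : TwoPointKP G Wd act 𝒜 n lip aP dP) (hdec : G.DecayExtract δv dP) (hpin : G.PinBudget aP δv (fun _ => B) κw)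
    (hexplZ : ∀ (k : ℕ) (Ue : E) (X : (doubleCarriers C₀).Dom), (doubleCarriers C₀).scale X = k + 1 →
      |explZ k Ue X| ≤ Real.exp (-(κw * (doubleCarriers C₀).d X)) * p₀ k)
    (hbase : ∀ g ∈ Wd, ∀ (Ue : E) (X : (doubleCarriers C₀).Dom), (doubleCarriers C₀).scale X = 0 →
      |Ef g Ue X| ≤ Real.exp (-(κw * (doubleCarriers C₀).d X)) * N 0)
    (hNsucc : ∀ j, p₀ j + 2 * B ≤ N (j + 1)) (hNnn : ∀ j, 0 ≤ N j)
    (hB : 0 ≤ B) (hlipb : ∀ k, lip k ≤ lipbar) (hpos' : 0 < ω + 8 * lipbar * B * ((1 + cr * aA) * cQ)) :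
    ∃ ε₃ aC εC ε₄ Rb R' j₁ : ℝ, 0 < ε₃ ∧ 0 < aC ∧ 0 < εC ∧ 0 < ε₄ ∧ 0 < Rb ∧ 0 < R' ∧ 0 < j₁ ∧ j₁ ≤ MJ ∧
      ∀ (U : Bond d (fineP L m) → 𝔸ˣ) {α : ℝ} (hα : α ≤ 1 / 128) (hα1 : α ≤ 1 / 64)
      (hU1 : ∀ (x : B7Prop1Explicit.Site d) (κ : Fin d), perCfg (fineP L m) U x κ ∈ U1 𝔸)
      (hreg : ∀ (y : TSite d m) (κ : Fin d) (r : Fin d → Fin L),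
        ‖((Wcx L (perCfg (fineP L m) U) (cornerSite L y) κ (boxVec L r) : 𝔸ˣ) : 𝔸) - 1‖ ≤ α)
      (hαL : 50 * (d + 1) * α * (L : ℝ) ^ d ≤ 1 / 2) {ε : ℝ}, 0 ≤ ε → ε ≤ ε₃ → (∀ b, ‖(U b : 𝔸) - 1‖ ≤ ε) →
      (∀ (b : Bond d (fineP L m)) (v u : W), inner ℂ (adTransportW φ U b v) u = inner ℂ v (adTransportW φ (fun b => (U b)⁻¹) b u)) →
      (∀ Y : Space115 (L : ℝ) η lev₀ lev₁ (nabla115 η U), ‖Y‖ < RV →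
          ‖curV0 (lev₁ := lev₁) (Dc := nabla115 η U) ρ τc U Y‖ ≤ CV * ‖Y‖ ^ 2) →
      ∀ (J : NegSize (L : ℝ) η lev₀ 3 𝔸) (Δπ : Space115 (L : ℝ) η lev₀ lev₁ (nabla115 η U) →L[ℂ] NegSize (L : ℝ) η lev₀ 3 𝔸),
        ‖J‖ ≤ j₁ → ‖Δπ‖ ≤ MΔ →
      ∃ hpos : ∀ x : BondL2K ℂ d (fineP L m) c₀ W, x ≠ 0 →
          0 < RCLike.re (inner ℂ x (laplaceAofBackground L m hL φ U hα1 hU1 hreg τ η (c₀ := c₀) (c₁ := c₁) a x)),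
      let Hc := H1LatticeCLM (lev₀ := lev₀) (levB := levB) φ hpos (QtorusW_surjective L m hL U hα1 hU1 hreg hαL φ) lev₁ (nabla115 η U)
      let Gc := frakGLatticeCLM (lev₀ := lev₀) φ hpos (QtorusW_surjective L m hL U hα1 hU1 hreg hαL φ) lev₁ (nabla115 η U)
      let Cx := Cc L m η U lev₀ lev₁ (nabla115 η U) levB
      ∀ (ιr : C₀.Dom → (E →L[ℂ] NegSize (L : ℝ) η levB 0 𝔸)) (πr : C₀.Dom → (Space115 (L : ℝ) η lev₀ lev₁ (nabla115 η U) →L[ℂ] E)),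
          (∀ X, MapsTo (ιr X) (ball 0 (Dd.R X)) (ball 0 Rb)) → (∀ X, MapsTo (πr X) (ball 0 R') (ball 0 (R₁ X))) →
          ∀ (Φ : C₀.Dom → E → E), (∀ X e, Φ X e = πr X (chartHB Gc (-(Gc.comp (LJ ρ τc Hc Cx J))) (W80 ρ τc U Hc Cx εC J Δπ) 0
              (fun A' => A' + solA Hc 0 Cx 0 εC A') ε₄ Hc (ιr X e))) →
          -- END-COMP's binders that mention the curve datum `Dd.compCur Φ R₁`
          LevelCountsG (Dd.compCur Φ R₁).toC.frame κw (Dd.compCur Φ R₁).κ₁ O1 cQ (fun k j => ℓg k j ^ 5) (agePow ω) →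
          Adm ⊆ analyticClass (Dd.compCur Φ R₁).R → A ∈ analyticClass (Dd.compCur Φ R₁).R →
          Factorises Ef Wd (compProj (cpieceChannel (Dd.compCur Φ R₁).toC) (margProj r A)) ΨF →
          (∀ (k : ℕ) (Q Q' : ι' → ℝ) (M : ℝ),
            (∀ y, |Q y - Q' y| ≤ weightOf (Dd.compCur Φ R₁).toC.frame (Dd.compCur Φ R₁).κ₁ d0 O1 ((Dd.compCur Φ R₁).Kp cdir) k y
              * M) → ‖ρP k Q - ρP k Q'‖ ≤ M) →
          (∀ (k : ℕ) (Q : ι' → ℝ),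
            (∀ y, |Q y| ≤ weightOf (Dd.compCur Φ R₁).toC.frame (Dd.compCur Φ R₁).κ₁ d0 O1 ((Dd.compCur Φ R₁).Kp cdir) k y *
              sizeRadius (fun k j => (1 + cr * aA) * tauOfG cQ (agePow ω) k j) N k) → ρP k Q ∈ 𝒜 k) →
          TermSize Ef Wd κw N ∧
            NE9 Ef Wd κw (prodModuli (8 * clipbar * B + 8 * lipbar * B *
                ((64 * (4 * clipd) * Nbar + cr * Nbar * (64 * (4 * clipd) * aA)) * cQ * (1 - ω)⁻¹))
              fun _ => ω + 8 * lipbar * B * ((1 + cr * aA) * cQ)) ∧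
              FadingMemory ((8 * clipbar * B + 8 * lipbar * B *
                    ((64 * (4 * clipd) * Nbar + cr * Nbar * (64 * (4 * clipd) * aA)) * cQ * (1 - ω)⁻¹)) /
                  (ω + 8 * lipbar * B * ((1 + cr * aA) * cQ)))
                (ω + 8 * lipbar * B * ((1 + cr * aA) * cQ))
                (prodModuli (8 * clipbar * B + 8 * lipbar * B *
                    ((64 * (4 * clipd) * Nbar + cr * Nbar * (64 * (4 * clipd) * aA)) * cQ * (1 - ω)⁻¹))
                  fun _ => ω + 8 * lipbar * B * ((1 + cr * aA) * cQ)) := by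
  obtain ⟨ε₃, aC, εC, a₃, C₄, ε₄, Rb, R', j₁, hε₃, haC, hεC, -, -, hε₄, hRb, hR', hj₁, hj₁M, H⟩ :=
    cur_chart_exists_oneInstance_smallField_uniform_smallJ L m hL φ hMφ hMφ' hφ hφ' τ hτ hCτ (η := η) (lev₀ := lev₀) (levB := levB) lev₁ hlev
      (c₀ := c₀) (c₁ := c₁) ha ρ τc hCV hRV hMJ hMΔ
  refine ⟨ε₃, aC, εC, ε₄, Rb, R', j₁, hε₃, haC, hεC, hε₄, hRb, hR', hj₁, hj₁M, ?_⟩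
  intro U α hα hα1 hU1 hreg hαL ε hε hεε₃ hUε hRS hqV J Δπ hJ hΔ
  obtain ⟨hpos, hmain⟩ := H U hα hα1 hU1 hreg hαL hε hεε₃ hUε hRS hqV J Δπ hJ hΔ
  refine ⟨hpos, ?_⟩
  intro Hc Gc Cx ιr πr hιr hπr Φ hΦ hLev hAdmAn hAan hfac hρ hbox
  obtain ⟨-, -, hΦ1, hΦ2, hΦ3⟩ := hmain
  exact termSize_ne9_and_fadingMemory_compCur_of_chart G hΦ1 hΦ2 hΦ3 ιr πr hιr hπr hΦ ρP U₀ explZ h0 hAdm hres hDd hdirB0 hdirC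
    hdirB hLev hAdmAn hrA hr0 hrs hA hcr haA hAan hAmul hcoef hnorm hS hclipd hcdir hℓpos hhalf hcont hlip hO1 hcQ hω0 hω1 hNb hfac
    hclip0 hCup hreprV hclipb hK hdec hpin hρ hexplZ hbase hNsucc hNnn hbox hB hlipb hpos'

end UniformBall

end Summit.QuantumFields.BalabanUV.T4Continuum.NE9CurOfOneInstanceChartEndUniform

end
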